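import Mathlib
import Literature.NumberTheory.EllipticCurves.Smith2016.CongruentNumberGenusDeterminantEvenForest
import Literature.NumberTheory.EllipticCurves.Smith2016.CongruentNumberGenusDeterminantRowsTwoThree

/-!
# Smith 2016, Theorem 2.2 row 2, PROVED for every number of prime factors: `smith_thm22_rowTwo_holds`

A. Smith, *The congruent numbers have positive natural density*, arXiv:1603.08479, Thm. 2.2 row 2
[Smith2016CongruentDensity]: for `n = 2p₁⋯p_k ≡ 2 (mod 8)` square-free (`∏ pᵢ ≡ 1 (mod 4)`),
`ℒ₂(n) = Σ_{d ∣ n, d ≡ n (16)} g(d) ℒ(n/d) = Σ_{n = d₀⋯d_ℓ, dᵢ ≡ 1 (8) (i > 0)} ∏ g(dᵢ)` equals, in `𝔽₂`, the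
determinant of (Smith's `M₂`, equivalently) Monsky's even matrix `M`.  The named fact `smith_thm22_rowTwo`
(`CongruentNumberGenusDeterminantRowsTwoThree`) is DISCHARGED here, for all `k`:
* `CongruentNumberGenusDeterminantEvenForest`: `det M = Σ_{S} g(2 d_S) · Σ_{D′ ∈ decompositions(d_{Sᶜ})}
  ∏ [d ≡ 1 (8)] g(d)` (forest formula, Smith's decomposition via `setExp_add`, Smith's lemma
  `det P = det (A + D_z)`, Rédei–Reichardt for `−8d`);
* this file: the genus sum of the EVEN number `2p₁⋯p_k` is the same sum — the decompositions of `n` are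
  grouped by the factor containing the prime `2` (Smith's recursion (eq:n1rec) at `p = 2`, i.e. the tree's
  `sum_decompositions_blockProd_rec` for the tuple `(2; p₁, …, p_k)` anchored at `2`), and a decomposition
  has at most one factor `≢ 1 (8)` iff all its ODD factors are `≡ 1 (8)` (its even factor never is).
Consequences already in the tree relative to the named fact become unconditional
(`CongruentNumberGenusDeterminantRowsTwoThreeConsequences`: Tian–Yuan–Zhang's (journal) Theorem 1.2 on
`n ≡ 2 (8)` for every `k`; see `CongruentNumberGenusDeterminantRowsTwoThreeUnconditional`).
-/

namespace Literature.NumberTheory.EllipticCurves.Smith2016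

open _root_.Matrix Finset Literature.LinearAlgebra.Matrix Literature.Combinatorics.Enumerative
open Literature.NumberTheory.EllipticCurves.HeathBrown1994
open Literature.NumberTheory.EllipticCurves.TianYuanZhang2017
open Literature.NumberTheory.EllipticCurves.MonskySelmerParity

section GenusSide

/-- **The even factor of a decomposition of an even number is unique**: for `2 ∣ n` and `D ∈ decompositions n`
there is exactly one `d₀ ∈ D` with `2 ∣ d₀` (the factors are pairwise coprime).
[cite: TianYuanZhang2017, Thm. 1.1 ("non-ordered decompositions with dᵢ > 1" of a square-free n)] -/
theorem exists_unique_even_of_mem_decompositions {n : ℕ} (hn : 2 ∣ n) {D : Finset ℕ}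
    (hD : D ∈ decompositions n) : ∃ d₀ ∈ D, 2 ∣ d₀ ∧ ∀ d ∈ D, 2 ∣ d → d = d₀ := by
  obtain ⟨-, -, hcop, hprod⟩ := mem_decompositions_iff.mp hD
  have h2 : 2 ∣ ∏ d ∈ D, d := by rw [hprod]; exact hn
  obtain ⟨d₀, hd₀, h2d₀⟩ := (Nat.Prime.prime Nat.prime_two).exists_mem_finset_dvd h2
  refine ⟨d₀, hd₀, h2d₀, fun d hd h2d => ?_⟩
  by_contra hne
  have hc : Nat.Coprime d d₀ := hcop hd hd₀ hne
  have : 2 ∣ Nat.gcd d d₀ := Nat.dvd_gcd h2d h2d₀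
  rw [hc] at this
  exact absurd this (by norm_num)

/-- For `2 ∣ n` and a decomposition `D` of `n`: the product of the weights `g(d)` (even `d`),
`[d ≡ 1 (8)] g(d)` (odd `d`) over `D` is `∏_D g(d)` if `D` has at most one factor `≢ 1 (mod 8)` (i.e. all
its odd factors are `≡ 1 (8)`), and `0` otherwise.
[cite: Smith2016CongruentDensity, §2 Table 2 row 2 (ℒ₂(n) = Σ_{d | n, d ≡ n (16)} g(d) ℒ(n/d))] [cite: TianYuanZhang2017, Thm. 1.1 (the sum Σ₁ for n ≡ 2 (8))] -/
theorem prod_evenWeight_eq_ite {n : ℕ} (hn : 2 ∣ n) {D : Finset ℕ} (hD : D ∈ decompositions n)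
    (g : ℕ → ℕ) :
    ∏ d ∈ D, (if d % 8 = 1 then ((g d : ℕ) : ZMod 2) else if d % 2 = 0 then ((g d : ℕ) : ZMod 2) else 0) =
      if (D.filter fun d => d % 8 ≠ 1).card ≤ 1 then ((∏ d ∈ D, g d : ℕ) : ZMod 2) else 0 := by
  obtain ⟨d₀, hd₀, h2d₀, huniq⟩ := exists_unique_even_of_mem_decompositions hn hD
  have hd₀8 : d₀ % 8 ≠ 1 := by
    intro h; have := Nat.mod_mod_of_dvd d₀ (by norm_num : 2 ∣ 8); omega
  have hmem : d₀ ∈ D.filter (fun d => d % 8 ≠ 1) := mem_filter.mpr ⟨hd₀, hd₀8⟩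
  by_cases hc : (D.filter fun d => d % 8 ≠ 1).card ≤ 1
  · rw [if_pos hc, Nat.cast_prod]
    have hF : {d₀} = D.filter (fun d => d % 8 ≠ 1) :=
      eq_of_subset_of_card_le (singleton_subset_iff.mpr hmem) (by rw [card_singleton]; exact hc)
    refine prod_congr rfl fun d hd => ?_
    by_cases hdd : d = d₀
    · subst hdd
      rw [if_neg hd₀8, if_pos (Nat.mod_eq_zero_of_dvd h2d₀)]
    · have h8 : d % 8 = 1 := by
        by_contra h8
        have : d ∈ D.filter (fun d => d % 8 ≠ 1) := mem_filter.mpr ⟨hd, h8⟩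
        rw [← hF, mem_singleton] at this
        exact hdd this
      rw [if_pos h8]
  · rw [if_neg hc]
    have hlt : 1 < (D.filter fun d => d % 8 ≠ 1).card := by omega
    obtain ⟨d', hd', hne⟩ := exists_mem_ne hlt d₀
    rw [mem_filter] at hd'
    have hodd' : d' % 2 ≠ 0 := by
      intro h
      exact hne (huniq d' hd'.1 (Nat.dvd_of_mod_eq_zero h))
    exact prod_eq_zero hd'.1 (by rw [if_neg hd'.2, if_neg hodd'])

/-- For `2 ∣ n`, the genus sum `ℒ₂ = genusSum₁ n g` in `𝔽₂` is the decomposition sum of the weight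
`d ↦ g(d)` (even `d`), `[d ≡ 1 (8)] g(d)` (odd `d`).
[cite: Smith2016CongruentDensity, §2 Table 2 row 2 with Thm. 2.1] [cite: TianYuanZhang2017, Thm. 1.1] -/
theorem natCast_genusSum₁_eq_sum_evenWeight {n : ℕ} (hn : 2 ∣ n) (g : ℕ → ℕ) :
    ((genusSum₁ n g : ℕ) : ZMod 2) =
      ∑ D ∈ decompositions n, ∏ d ∈ D,
        (if d % 8 = 1 then ((g d : ℕ) : ZMod 2) else if d % 2 = 0 then ((g d : ℕ) : ZMod 2) else 0) := by
  unfold genusSum₁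
  rw [Nat.cast_sum, sum_filter]
  refine sum_congr rfl fun D hD => ?_
  rw [prod_evenWeight_eq_ite hn hD g]

end GenusSide

section Anchor

variable {k : ℕ} (p : Fin k → ℕ)

/-- The odd primes of `(2; p₁, …, p_k)` are the image of `succ`: `univ ∖ {0} = succ(univ)`.
[cite: LiMa2008, Lemma 0.1 (p. 279)] -/
theorem univ_erase_zero_eq_map :
    (univ : Finset (Fin (k + 1))).erase 0 = univ.map ⟨Fin.succ, Fin.succ_injective k⟩ := by
  ext i
  simp only [mem_erase, mem_univ, and_true, mem_map, Function.Embedding.coeFn_mk, true_and]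
  rw [Fin.exists_succ_eq]

/-- Re-indexing sums over subsets of `succ(T)` by subsets of `T`.
[cite: Stanley1999EC2, Cor. 5.1.6 (exponential formula; elementary finite form)] -/
theorem sum_powerset_map_succ {R : Type*} [AddCommMonoid R] (T : Finset (Fin k)) (F : Finset (Fin (k + 1)) → R) :
    ∑ B ∈ (T.map ⟨Fin.succ, Fin.succ_injective k⟩).powerset, F B =
      ∑ S ∈ T.powerset, F (S.map ⟨Fin.succ, Fin.succ_injective k⟩) := by
  rw [map_eq_image, powerset_image, sum_image]
  · exact sum_congr rfl fun S _ => by rw [map_eq_image]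
  · intro S _ S' _ h
    dsimp only at h
    rw [← map_eq_image, ← map_eq_image] at h
    exact map_injective _ h

/-- `∏_{i ∈ {0} ∪ succ(S)} (2; p)_i = 2 · ∏_{j ∈ S} p_j`. [cite: LiMa2008, Lemma 0.1 (p. 279)] -/
theorem prod_insert_zero_map_succ (S : Finset (Fin k)) :
    ∏ i ∈ insert (0 : Fin (k + 1)) (S.map ⟨Fin.succ, Fin.succ_injective k⟩),
        (Fin.cons 2 p : Fin (k + 1) → ℕ) i = 2 * ∏ j ∈ S, p j := by
  rw [prod_insert, Fin.cons_zero, prod_map]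
  · simp only [Function.Embedding.coeFn_mk, Fin.cons_succ]
  · simp

/-- `(univ ∖ {0}) ∖ succ(S) = succ(univ ∖ S)` and its product. [cite: LiMa2008, Lemma 0.1 (p. 279)] -/
theorem prod_erase_zero_sdiff_map_succ (S : Finset (Fin k)) :
    ∏ i ∈ (univ : Finset (Fin (k + 1))).erase 0 \ S.map ⟨Fin.succ, Fin.succ_injective k⟩,
        (Fin.cons 2 p : Fin (k + 1) → ℕ) i = ∏ j ∈ univ \ S, p j := by
  rw [univ_erase_zero_eq_map, ← Finset.map_sdiff, prod_map]
  simp only [Function.Embedding.coeFn_mk, Fin.cons_succ]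

/-- **The genus sum of `2p₁⋯p_k`, grouped by the factor containing `2`**: in `𝔽₂`,
`ℒ₂(2∏pᵢ) = Σ_{S ⊆ [k]} g(2 d_S) · Σ_{D′ ∈ decompositions(d_{Sᶜ})} ∏_{d ∈ D′} [d ≡ 1 (8)] g(d)`
(Smith's `Σ_{d | n even} g(d) ℒ(n/d)`). [cite: Smith2016CongruentDensity, §2 Table 2 row 2 and Definition of ℒ, (eq:n1rec)] [cite: TianYuanZhang2017, Thm. 1.1] -/
theorem natCast_genusSum₁_two_mul_eq_sum_powerset (hp : ∀ i, (p i).Prime) (hodd : ∀ i, Odd (p i))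
    (hinj : Function.Injective p) :
    ((genusSum₁ (2 * ∏ i, p i) (fun d => genusClassNumber (GenusField d)) : ℕ) : ZMod 2) =
      ∑ S ∈ (univ : Finset (Fin k)).powerset,
        ((genusClassNumber (GenusField (2 * ∏ i ∈ S, p i)) : ℕ) : ZMod 2) *
          ∑ D ∈ decompositions (∏ i ∈ univ \ S, p i), ∏ d ∈ D,
            (if d % 8 = 1 then ((genusClassNumber (GenusField d) : ℕ) : ZMod 2) else 0) := by
  have hq := prime_cons_two p hp
  have hqinj := injective_cons_two p hodd hinj
  rw [natCast_genusSum₁_eq_sum_evenWeight (dvd_mul_right 2 _), ← prod_cons_two_eq p,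
    show (∏ i, (Fin.cons 2 p : Fin (k + 1) → ℕ) i) = ∏ i ∈ (univ : Finset (Fin (k + 1))),
      (Fin.cons 2 p : Fin (k + 1) → ℕ) i from rfl,
    sum_decompositions_blockProd_rec (Fin.cons 2 p) hq hqinj _ (mem_univ (0 : Fin (k + 1))),
    univ_erase_zero_eq_map, sum_powerset_map_succ, ← univ_erase_zero_eq_map]
  refine sum_congr rfl fun S _ => ?_
  rw [prod_insert_zero_map_succ p S, prod_erase_zero_sdiff_map_succ p S]
  have heven : (2 * ∏ j ∈ S, p j) % 2 = 0 := by omega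
  have hne1 : (2 * ∏ j ∈ S, p j) % 8 ≠ 1 := by omega
  rw [if_neg hne1, if_pos heven]
  congr 1
  refine sum_congr rfl fun D' hD' => prod_congr rfl fun d hd => ?_
  -- no factor of `D′` is divisible by `2 = (2; p)₀`
  have hS : S.map ⟨Fin.succ, Fin.succ_injective k⟩ ⊆ (univ : Finset (Fin (k + 1))).erase 0 := by
    intro i hi
    rw [mem_map] at hi
    obtain ⟨j, -, rfl⟩ := hi
    exact mem_erase.mpr ⟨Fin.succ_ne_zero j, mem_univ _⟩
  have hD'' : D' ∈ decompositions (∏ i ∈ (univ : Finset (Fin (k + 1))).erase 0 \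
      S.map ⟨Fin.succ, Fin.succ_injective k⟩, (Fin.cons 2 p : Fin (k + 1) → ℕ) i) := by
    rw [prod_erase_zero_sdiff_map_succ p S]; exact hD'
  have h2 := (insert_blockProd_mem_decompositions (Fin.cons 2 p) hq hqinj (mem_univ (0 : Fin (k + 1)))
    hS hD'').2.1 d hd
  rw [Fin.cons_zero] at h2
  have hodd : d % 2 ≠ 0 := fun h => h2 (Nat.dvd_of_mod_eq_zero h)
  by_cases h8 : d % 8 = 1
  · rw [if_pos h8, if_pos h8]
  · rw [if_neg h8, if_neg h8, if_neg hodd]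

end Anchor

section RowTwo

/-- **Smith 2016, Theorem 2.2, row 2 — PROVED for every `k`**: for `n = 2p₁⋯p_k` with distinct odd `pᵢ` and
`∏ pᵢ ≡ 1 (mod 4)`, `ℒ₂(n) = Σ_{n = d₀⋯d_ℓ, dᵢ ≡ 1 (8) (i>0)} ∏ᵢ g(dᵢ) ≡ det M (mod 2)`, `M` Monsky's even
matrix: the named fact `smith_thm22_rowTwo` discharged.  Proof: a column-block swap makes `M` the
doubled forest matrix with marks `t`; the forest formula and `setExp_add` give Smith's decomposition
`Σ_S det P[S] · det M₁[Sᶜ]`; Smith's lemma `det P[S] = det (A^S + D_z) ≡ g(2d_S)` (`Σ_S t = 0`) and the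
row-1 dictionary evaluate the terms; the genus sum is regrouped by the factor containing `2`.
[cite: Smith2016CongruentDensity, Thm. 2.2 row 2 (arXiv:1603.08479 §2, chunk p0005 L59–L63) and §2.2 (chunk p0009 L11 – p0010 L8)] -/
theorem smith_thm22_rowTwo_holds : smith_thm22_rowTwo := by
  intro k p hp hodd hinj h4
  rw [natCast_genusSum₁_two_mul_eq_sum_powerset p hp hodd hinj,
    det_monskyMatrixEven_eq_sum_genusWeight p hp hodd hinj h4]

end RowTwo

end Literature.NumberTheory.EllipticCurves.Smith2016
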